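import Summits.ResolutionOfSingularities.ResolutionOfSingularities.Theorems.CossartPiltant2019PrincipalizationHolds
import HarnessLib

/-!
# Stub `stub_CP2019Principalization` of line `Sketch` (skeleton v10c, sha16 `f3e6993bf39ec5c9`) for the crux
# `EquisingularLift` (stmt-ResolutionOfSingularities-15660)

OURS (leafhand-res-equisingularlift-1 g0, 2026-08-30). The registered stub asks for the tree's named fact
`Literature.AlgebraicGeometry.Resolution.CossartPiltant2019Principalization` (Cossart–Piltant 2019, Prop. 4.4:
principalization on regular excellent threefolds) at universe `0`. That fact was DISCHARGED in the tree on 2026-08-28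
(`Summit.ResolutionOfSingularities.ResolutionOfSingularities.Theorems.CP2008Prop44.CossartPiltant2019Principalization_holds`,
file `Theorems/CossartPiltant2019PrincipalizationHolds.lean`, from the sorry-free Prop. 4.4 assembly
`cossartPiltant2008_prop44_holds`), one day after the skeleton was registered; this file specialises it to universe `0`
under the registered stub name. AI-written; AI review is weaker than expert review. Closing this stub advances one leaf of
one line; it proves nothing about resolution in dimension `≥ 4` or in positive characteristic, and asserts nothing of any
manuscript under adjudication.
-/

-- `Summit.<Summit>.<Sub>.…` with `Sub = Summit` (single-conjunct summit, D-0017)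
set_option linter.dupNamespace false

noncomputable section

namespace Summit.ResolutionOfSingularities.ResolutionOfSingularities.Cruxes.EquisingularLift.StrataSplit

/-- **Stub `stub_CP2019Principalization`** (registered signature, verbatim): the tree's named fact
`CossartPiltant2019Principalization` at universe `0` — Cossart–Piltant 2019 Prop. 4.4 (= [CoP1] Prop. 4.2),
principalization of ideals on regular excellent schemes of dimension three by permissible blow-ups.
Proof: the landed discharge `CP2008Prop44.CossartPiltant2019Principalization_holds`.
[cite: CossartPiltant2019, Prop. 4.4] [cite: CossartPiltant2008, Prop. 4.2] -/
theorem stub_CP2019Principalization :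
    Literature.AlgebraicGeometry.Resolution.CossartPiltant2019Principalization.{0} :=
  Summit.ResolutionOfSingularities.ResolutionOfSingularities.Theorems.CP2008Prop44.CossartPiltant2019Principalization_holds.{0}

end Summit.ResolutionOfSingularities.ResolutionOfSingularities.Cruxes.EquisingularLift.StrataSplit

end
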